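import Summits.ResolutionOfSingularities.ResolutionOfSingularities.Theorems.PurelyInseparableDim4SpivakovskySelectWin
import Summits.ResolutionOfSingularities.ResolutionOfSingularities.Theorems.PurelyInseparableDim4RuleS
import HarnessLib

/-!
# [OURS · res-dim4-pi PR-9c, MODE S of record] The engines' rule `R_S` verbatim: least cardinality, then lex — a
  kernel-evaluable tree object that wins

Cell `res-dim4-pi` (D-0157 DOOR 2), seat `res-dim4-p-11`; desk WORD #32 (d)(ii) («a `stratC` for the FULL R_S … tie-break
least-cardinality-then-lex = eng-B's 16:28:11Z rule; idea-2's executable R_S (`spiv.py`, `_minimal_gamma(pick='lex')`) is the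
reference implementation … so that «engine R_S = stratC» is a per-position kernel certificate AND F4-C's witness rule has a
tree object»).  Source of the rule: [cite: Spivakovsky1983, §II (Γ_r «a minimal one among those permissible»), Remark 2].

* §1 `combosLex l k` — the `k`-element sublists of `l` in the order of `itertools.combinations` (lex on positions), and the
  ONE-VERTEX SELECTOR OF RECORD `minPermLex I G`: the first permissible `Γ ⊆ I` in the order (cardinality, then lex on the
  sorted index tuple) — exactly `spiv.py`'s `_minimal_gamma(I, gens, 1, 'lex')[0]`; defined WITHOUT `Classical.choose`
  (lists + `List.find?`), so the kernel evaluates it (`decide +kernel`);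
* §2 `isMinPermSel_minPermLex` — it is an admissible selector (least cardinality ⇒ no proper subset permissible);
* §3 **`stratLex := stratWith minPermLex`** — MODE S of record on rational positions; `perm_stratLex`, `no_strategy_play_lex`
  (Remark 2 instantiated: this tie-break wins too);
* §4 the spine / state forms: `spineRuleLex q` (supports), `isPurePositionalWin_spineRuleLex`, `ruleLex q : CentreRule K`
  (states; F4-C's witness candidate of record, NAMED — nothing about F4-C is proved), `isPermissibleRule_ruleLex`,
  `spineTerminatesUnder_ruleLex`;
* §5 KERNEL CERTIFICATE SHAPE: `spineRuleLexFun 2 A = S` by `decide +kernel` (mirror on `Fin 4 → ℕ`, `spineRuleLex_map_equivFunOnFinite_symm`) on census supports (C-003's position and rows 0, 3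
  of eng-B's `RS-random-1000.tsv` 0a01e8d6941b5350) — the per-position «engine R_S(A) = R_S of the tree» certificate the
  K lane can batch.

[OURS · counted 0 · AI work weaker than expert review] Statements about OUR frame's coordinate game; NOTHING here proves resolution
of singularities in dimension ≥ 4 / characteristic `p`. bears_on: LADDER-RESOLUTION:D157-DOOR2 (res-dim4-pi · MODE S of record).
Supports stmt-ResolutionOfSingularities-16155 (helper).
-/

set_option linter.dupNamespace false -- mandated namespace of this single-conjunct summit

open Finset
open scoped BigOperators

namespace Summit.ResolutionOfSingularities.ResolutionOfSingularities.Theorems.PIDim4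

namespace Spivakovsky

/-! ## §1 Combinations in lex order and the selector of record -/

/-- The `k`-element sublists of `l`, in the order of `itertools.combinations(l, k)` (those through the head first).
[folklore] -/
def combosLex {α : Type} : List α → ℕ → List (List α)
  | _, 0 => [[]]
  | [], _ + 1 => []
  | a :: l, k + 1 => (combosLex l k).map (fun c => a :: c) ++ combosLex l (k + 1)

/-- Every element of `combosLex l k` is a sublist of `l` of length `k`. [folklore] -/
theorem sublist_of_mem_combosLex {α : Type} :
    ∀ (l : List α) (k : ℕ) (c : List α), c ∈ combosLex l k → c.Sublist l ∧ c.length = k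
  | l, 0, c, h => by
    simp only [combosLex, List.mem_singleton] at h
    subst h; exact ⟨List.nil_sublist _, rfl⟩
  | [], k + 1, c, h => by simp [combosLex] at h
  | a :: l, k + 1, c, h => by
    simp only [combosLex, List.mem_append, List.mem_map] at h
    rcases h with ⟨c', hc', rfl⟩ | h
    · obtain ⟨hs, hl⟩ := sublist_of_mem_combosLex l k c' hc'
      exact ⟨hs.cons_cons a, by simp [hl]⟩
    · obtain ⟨hs, hl⟩ := sublist_of_mem_combosLex l (k + 1) c h
      exact ⟨hs.cons a, hl⟩

/-- **Completeness**: every sublist of `l` of length `k` occurs in `combosLex l k`. [folklore] -/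
theorem mem_combosLex_of_sublist {α : Type} {l c : List α} (h : c.Sublist l) : c ∈ combosLex l c.length := by
  induction h with
  | slnil => simp [combosLex]
  | @cons c l a _ ih =>
    cases c with
    | nil => simp [combosLex]
    | cons b c' =>
      simp only [List.length_cons, combosLex, List.mem_append] at ih ⊢
      exact Or.inr ih
  | @cons_cons c l a _ ih =>
    simp only [List.length_cons, combosLex, List.mem_append, List.mem_map]
    exact Or.inl ⟨c, ih, rfl⟩

variable {n : ℕ}

/-- The indices of `I ⊆ Fin n` in increasing order (no sorting: a filtered `List.finRange`). [folklore] -/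
def sortedList (I : Finset (Fin n)) : List (Fin n) := (List.finRange n).filter (fun i => i ∈ I)

/-- `sortedList I` lists exactly the elements of `I`, without duplicates. [folklore] -/
theorem mem_sortedList_iff (I : Finset (Fin n)) (i : Fin n) : i ∈ sortedList I ↔ i ∈ I := by
  simp [sortedList]

/-- `sortedList I` has no duplicates. [folklore] -/
theorem nodup_sortedList (I : Finset (Fin n)) : (sortedList I).Nodup :=
  (List.nodup_finRange n).filter _

/-- All candidate subsets of `I` in the order (cardinality, then lex), as lists. [folklore] -/
def candidatesLex (I : Finset (Fin n)) : List (List (Fin n)) :=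
  (List.range (I.card + 1)).flatMap (fun k => combosLex (sortedList I) k)

/-- `Bool`-valued permissibility test (for `List.find?` and kernel evaluation). [folklore] -/
def permB (Γ : Finset (Fin n)) (G : Pos (Fin n)) : Bool :=
  decide (Γ ≠ ∅) && decide (∀ g ∈ G, 1 ≤ ∑ j ∈ Γ, g j)

/-- `permB` decides `Perm`. [folklore] -/
theorem permB_eq_true_iff (Γ : Finset (Fin n)) (G : Pos (Fin n)) : permB Γ G = true ↔ Perm Γ G := by
  simp [permB, Perm, Finset.nonempty_iff_ne_empty]

/-- **THE ONE-VERTEX SELECTOR OF RECORD** (`spiv.py` `_minimal_gamma(pick='lex')`, eng-B 16:28:11Z): the first permissible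
`Γ ⊆ I` in the order «least cardinality, then lexicographic on the sorted index tuple»; `∅` if none is permissible.
[cite: Spivakovsky1983, §II (Γ_r), Remark 2] -/
def minPermLex (I : Finset (Fin n)) (G : Pos (Fin n)) : Finset (Fin n) :=
  (((candidatesLex I).find? (fun c => permB c.toFinset G)).map List.toFinset).getD ∅

/-! ## §2 The selector of record is admissible -/

/-- A sublist of `sortedList I`, read as a finset, lies in `I`. [folklore] -/
theorem toFinset_subset_of_sublist {I : Finset (Fin n)} {c : List (Fin n)} (h : c.Sublist (sortedList I)) :
    c.toFinset ⊆ I := fun i hi => (mem_sortedList_iff I i).mp (h.subset (List.mem_toFinset.mp hi))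

/-- A subset `Γ ⊆ I` occurs (as the list of its elements in increasing order) in block `#Γ` of `candidatesLex I`.
[folklore] -/
theorem exists_mem_combosLex_of_subset {I Γ : Finset (Fin n)} (hΓ : Γ ⊆ I) :
    ∃ c ∈ combosLex (sortedList I) Γ.card, c.toFinset = Γ := by
  set c := (sortedList I).filter (fun i => i ∈ Γ) with hc
  have hsub : c.Sublist (sortedList I) := List.filter_sublist
  have hnd : c.Nodup := (nodup_sortedList I).filter _
  have hcF : c.toFinset = Γ := by
    ext i
    simp only [hc, List.mem_toFinset, List.mem_filter, mem_sortedList_iff, decide_eq_true_eq]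
    exact ⟨fun h => h.2, fun h => ⟨hΓ h, h⟩⟩
  have hlen : c.length = Γ.card := by
    rw [← hcF, List.card_toFinset, List.dedup_eq_self.mpr hnd]
  exact ⟨c, hlen ▸ mem_combosLex_of_sublist hsub, hcF⟩

/-- If a permissible `Γ ⊆ I` exists, `minPermLex I G` is found by `List.find?`: it is permissible, inside `I`, and of
cardinality `≤` that of every permissible subset of `I`. [folklore] -/
theorem minPermLex_spec {I : Finset (Fin n)} {G : Pos (Fin n)} (h : ∃ Γ ⊆ I, Perm Γ G) :
    minPermLex I G ⊆ I ∧ Perm (minPermLex I G) G ∧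
      ∀ Γ ⊆ I, Perm Γ G → (minPermLex I G).card ≤ Γ.card := by
  classical
  -- the search succeeds
  obtain ⟨Γ₀, hΓ₀I, hΓ₀P⟩ := h
  have hfind : ((candidatesLex I).find? (fun c => permB c.toFinset G)).isSome := by
    rw [List.find?_isSome]
    obtain ⟨c, hc, hcF⟩ := exists_mem_combosLex_of_subset hΓ₀I
    refine ⟨c, ?_, by rw [permB_eq_true_iff, hcF]; exact hΓ₀P⟩
    simp only [candidatesLex, List.mem_flatMap, List.mem_range]
    exact ⟨Γ₀.card, Nat.lt_succ_of_le (Finset.card_le_card hΓ₀I), hc⟩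
  obtain ⟨c₀, hc₀⟩ := Option.isSome_iff_exists.mp hfind
  have hres : minPermLex I G = c₀.toFinset := by
    unfold minPermLex; rw [hc₀]; rfl
  -- unpack `find? = some c₀` through the `flatMap`
  rw [candidatesLex, List.find?_flatMap, List.findSome?_eq_some_iff] at hc₀
  obtain ⟨l₁, k₀, l₂, hsplit, hk₀, hbefore⟩ := hc₀
  obtain ⟨hP, hc₀mem⟩ : Perm c₀.toFinset G ∧ c₀ ∈ combosLex (sortedList I) k₀ := by
    have h1 := List.find?_some hk₀
    have h2 := List.mem_of_find?_eq_some hk₀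
    exact ⟨(permB_eq_true_iff _ _).mp h1, h2⟩
  obtain ⟨hsub, hlen⟩ := sublist_of_mem_combosLex _ _ _ hc₀mem
  refine ⟨hres ▸ toFinset_subset_of_sublist hsub, hres ▸ hP, fun Γ hΓI hΓP => ?_⟩
  -- a permissible `Γ ⊆ I` of smaller cardinality would sit in an earlier block, where nothing was found
  rw [hres]
  by_contra hlt
  push Not at hlt
  have hcard : c₀.toFinset.card ≤ k₀ := hlen ▸ List.toFinset_card_le c₀
  have hΓk : Γ.card < k₀ := lt_of_lt_of_le hlt hcard
  -- `Γ.card` is in the prefix `l₁` of `List.range (I.card + 1) = l₁ ++ k₀ :: l₂`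
  have hmem_range : Γ.card ∈ List.range (I.card + 1) :=
    List.mem_range.mpr (Nat.lt_succ_of_le (Finset.card_le_card hΓI))
  have hmem_l₁ : Γ.card ∈ l₁ := by
    rw [hsplit] at hmem_range
    rcases List.mem_append.mp hmem_range with h1 | h2
    · exact h1
    · exfalso
      -- `List.range` is strictly increasing: everything from position `|l₁|` on is `≥ k₀`
      have hsorted : (l₁ ++ k₀ :: l₂).Pairwise (· < ·) := hsplit ▸ List.pairwise_lt_range
      rw [List.pairwise_append] at hsorted
      have hk₀l₂ : (k₀ :: l₂).Pairwise (· < ·) := hsorted.2.1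
      rcases List.mem_cons.mp h2 with h3 | h3
      · omega
      · have := List.rel_of_pairwise_cons hk₀l₂ h3; omega
  have hnone := hbefore _ hmem_l₁
  obtain ⟨c, hc, hcF⟩ := exists_mem_combosLex_of_subset hΓI
  have := List.find?_eq_none.mp hnone c hc
  rw [hcF] at this
  exact this ((permB_eq_true_iff _ _).mpr hΓP)

/-- **The selector of record is admissible** (Spivakovsky's requirement on `Γ_r`; least cardinality ⇒ minimal for
inclusion). [cite: Spivakovsky1983, §II, Remark 2] -/
theorem isMinPermSel_minPermLex : IsMinPermSel (minPermLex : Finset (Fin n) → Pos (Fin n) → Finset (Fin n)) := by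
  intro I G hex
  obtain ⟨hI, hP, hmin⟩ := minPermLex_spec hex
  refine ⟨hI, hP, fun Γ' hss hP' => ?_⟩
  have := hmin Γ' (hss.1.trans hI) hP'
  exact absurd (Finset.card_lt_card hss) (not_lt.mpr this)

/-! ## §3 MODE S of record on rational positions -/

/-- **`R_S` of record**: Spivakovsky's strategy with the one-vertex choice «least cardinality, then lex».
[cite: Spivakovsky1983, §II] -/
noncomputable def stratLex (I : Finset (Fin n)) (G : Pos (Fin n)) : Finset (Fin n) := stratWith minPermLex I G

/-- It is permissible at every good position with `d ≥ 1`. [cite: Spivakovsky1983, §III Corollary] -/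
theorem perm_stratLex {I : Finset (Fin n)} {G : Pos (Fin n)} (hgood : Good I G) (hd : 1 ≤ dG I G) :
    Perm (stratLex I G) G :=
  perm_stratWith isMinPermSel_minPermLex hgood hd

/-- **It wins** (no infinite play through good positions with `d ≥ 1` and bounded denominators).
[cite: Spivakovsky1983, Theorem p. 421, Remark 2] -/
theorem no_strategy_play_lex (I : Finset (Fin n)) {N : ℕ} (hN : 0 < N) (P : ℕ → Pos (Fin n)) (ι : ℕ → Fin n)
    (hgood : ∀ l, Good I (P l)) (hden : ∀ l, Den N (P l)) (hd : ∀ l, 1 ≤ dG I (P l))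
    (hι : ∀ l, ι l ∈ stratLex I (P l)) (hstep : ∀ l, P (l + 1) = (P l).image (move (stratLex I (P l)) (ι l))) :
    False :=
  no_strategy_play_sel' isMinPermSel_minPermLex I hN P ι hgood hden hd hι hstep

/-! ## §4 The spine and state forms of `R_S` -/

/-- **MODE S of record on supports** (four variables, threshold `q`). [cite: Spivakovsky1983, §II] -/
noncomputable def spineRuleLex (q : ℕ) : SpineStrategy :=
  fun A => stratLex (Finset.univ : Finset (Fin 4)) (A.image (spineScale q))

namespace SpineRuleLex

variable {q : ℕ}

/-- `R_S` is permissible while A has not won. [cite: Spivakovsky1983, §III Corollary] -/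
theorem spinePermissible (hq : 0 < q) {A : SpinePos} (hA : ¬ SpineWon q A) :
    SpinePermissible q (spineRuleLex q A) A := by
  have hne : A.Nonempty := by
    rw [Finset.nonempty_iff_ne_empty]; exact fun h => hA (Or.inl h)
  have hperm := perm_stratLex (SpineRuleS.good_image A hne) (SpineRuleS.one_le_dG_image hq hA)
  refine ⟨hperm.1, fun a ha => ?_⟩
  have h1 := hperm.2 _ (Finset.mem_image_of_mem (spineScale q) ha)
  have hqq : (0 : ℚ) < q := by exact_mod_cast hq
  rw [show stratLex univ (A.image (spineScale q)) = spineRuleLex q A from rfl, SpineRuleS.sum_spineScale,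
    le_div_iff₀ hqq, one_mul] at h1
  exact_mod_cast h1

/-- **`R_S` of record wins the pure spine game** (positional). [cite: Spivakovsky1983, Theorem p. 421, Remark 2] -/
theorem isPurePositionalWin (hq : 0 < q) : IsPurePositionalWin q (spineRuleLex q) := by
  refine ⟨fun A hA => spinePermissible hq hA, ?_⟩
  rintro ⟨A, hplay⟩
  have hW : ∀ l, ¬ SpineWon q (A l) := fun l => (hplay l).1
  have hne : ∀ l, (A l).Nonempty := fun l => by
    rw [Finset.nonempty_iff_ne_empty]; exact fun h => hW l (Or.inl h)
  choose ι hιmem hιstep using fun l => (hplay l).2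
  refine no_strategy_play_lex (Finset.univ : Finset (Fin 4)) hq (fun l => (A l).image (spineScale q)) ι
    (fun l => SpineRuleS.good_image (A l) (hne l)) (fun l => SpineRuleS.den_image hq (A l))
    (fun l => SpineRuleS.one_le_dG_image hq (hW l)) (fun l => hιmem l) (fun l => ?_)
  show (A (l + 1)).image (spineScale q) =
    ((A l).image (spineScale q)).image (Spivakovsky.move (spineRuleLex q (A l)) (ι l))
  rw [hιstep l]
  exact SpineRuleS.image_pureMove hq (spinePermissible hq (hW l))

/-- `R_S` of record wins the spine game with deletions as well (LEMMA D1). [folklore] -/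
theorem isSpinePositionalWin (hq : 0 < q) : IsSpinePositionalWin q (spineRuleLex q) := by
  obtain ⟨hperm, hno⟩ := isPurePositionalWin hq
  refine ⟨hperm, ?_⟩
  rintro ⟨A, hA⟩
  exact hno ⟨fun k => A (k + 1), SpineD1.isPurePlay_succ_of_isSpinePlay hperm hA⟩

end SpineRuleLex

/-- **`R_S` of record as a STATE rule** (read the centre off the support of the cleaned `F`; the point at `F = 0`) — the
rule the engines run as MODE S, and F4-C's witness candidate of record (nothing about F4-C is proved here).
[cite: Spivakovsky1983, §II] -/
noncomputable def ruleLex {K : Type} [Field K] [DecidableEq K] (q : ℕ) : CentreRule K :=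
  fun s => if s.F = 0 then (Finset.univ : Finset (Fin 4)) else spineRuleLex q s.F.support

namespace SpineRuleLex

variable {K : Type} [Field K] [DecidableEq K] {q : ℕ}

/-- `ruleLex` reads `spineRuleLex` off the support of every non-zero `F`. [folklore] -/
theorem ruleLex_eq_of_ne_zero (s : State K) (hs : s.F ≠ 0) : ruleLex q s = spineRuleLex q s.F.support := by
  simp [ruleLex, hs]

/-- At `F = 0` the rule names the point. [folklore] -/
theorem ruleLex_eq_of_eq_zero (s : State K) (hs : s.F = 0) : ruleLex q s = Finset.univ := by
  simp [ruleLex, hs]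

/-- `R_S` of record is a permissible rule. [cite: Spivakovsky1983, §III Corollary] -/
theorem isPermissibleRule_ruleLex (hq : 0 < q) : IsPermissibleRule q (ruleLex (K := K) q) :=
  SpineDictionary.isPermissibleRule_of_agrees q (spineRuleLex q) (fun _ hA => spinePermissible hq hA)
    (fun s hs => ruleLex_eq_of_ne_zero s hs) (fun s hs => by rw [ruleLex_eq_of_eq_zero s hs]; exact Finset.univ_nonempty)

/-- **`R_S` of record has no infinite spine branch**, over every field. [cite: Spivakovsky1983, Theorem p. 421] -/
theorem spineTerminatesUnder_ruleLex (hq : 0 < q) : SpineTerminatesUnder q (ruleLex (K := K) q) :=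
  ((SpineDictionary.isSpinePositionalWin_iff q (spineRuleLex q) (R := ruleLex (K := K) q)
    (fun s hs => ruleLex_eq_of_ne_zero s hs)).mp (isSpinePositionalWin hq)).2

end SpineRuleLex

/-! ## §5 Kernel certificate shape: `R_S` evaluated by the kernel on census supports -/

/-- `R_S` of record read on PLAIN exponent functions `Fin 4 → ℕ` (the certifiers' mirror type, p-8 `SpineCert`):
the same rational position, built without `Finsupp`. [folklore] -/
noncomputable def spineRuleLexFun (q : ℕ) (A : Finset (Fin 4 → ℕ)) : Finset (Fin 4) :=
  stratLex (Finset.univ : Finset (Fin 4)) (A.image (fun a k => (a k : ℚ) / q))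

/-- The mirror agrees with `spineRuleLex` on the corresponding `Finsupp` position. [folklore] -/
theorem spineRuleLex_map_equivFunOnFinite_symm (q : ℕ) (A : Finset (Fin 4 → ℕ)) :
    spineRuleLex q (A.map (Finsupp.equivFunOnFinite.symm.toEmbedding)) = spineRuleLexFun q A := by
  unfold spineRuleLex spineRuleLexFun
  congr 1
  rw [Finset.map_eq_image, Finset.image_image]
  exact Finset.image_congr fun a _ => by
    funext k
    simp [spineScale, Function.comp_apply]

/-- C-003's cycle position `A₀ = {x₂x₃²x₄², x₂x₃³x₄, x₁x₂x₃x₄³}` (p-8 `SpineCert.c003A₀`): `R_S` blows up the PLANE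
`V(z, x₃, x₄)` there — not MODE 1h-lex's `{x₁, x₃}` of the certified 2-cycle. [OURS · ‖ K] [folklore] -/
theorem spineRuleLexFun_c003A₀ :
    spineRuleLexFun 2 {![0, 1, 2, 2], ![0, 1, 3, 1], ![1, 1, 1, 3]} = {2, 3} := by
  decide +kernel

/-- Row 0 of eng-B's `RS-random-1000.tsv` (0a01e8d6941b5350): support `{(2,1,2,3), (5,6,4,5), (6,1,0,6)}`, engine
output `S_B = {x₁, x₃}` — the kernel agrees. [OURS · ‖ K] [folklore] -/
theorem spineRuleLexFun_RS_random_row0 :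
    spineRuleLexFun 2 {![2, 1, 2, 3], ![5, 6, 4, 5], ![6, 1, 0, 6]} = {0, 2} := by
  decide +kernel

/-- Row 3 of eng-B's `RS-random-1000.tsv`: support `{(0,6,5,3), (2,2,4,5)}`, engine output `S_B = {x₁, x₂, x₄}` — the
kernel agrees. [OURS · ‖ K] [folklore] -/
theorem spineRuleLexFun_RS_random_row3 :
    spineRuleLexFun 2 {![0, 6, 5, 3], ![2, 2, 4, 5]} = {0, 1, 3} := by
  decide +kernel

end Spivakovsky

end Summit.ResolutionOfSingularities.ResolutionOfSingularities.Theorems.PIDim4
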